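import Mathlib.Analysis.Complex.Polynomial.Basic
import Mathlib.FieldTheory.IsAlgClosed.Basic
import Mathlib.FieldTheory.IntermediateField.Algebraic
import Literature.Barriers.Schanuel.EFunctionValuesAtAlgebraicPointsSeries
import Literature.Barriers.Schanuel.EFunctionValuesAtAlgebraicPointsProofs
import HarnessLib

/-!
# Barrier (Schanuel) `EFunctionValuesAtAlgebraicPoints`: the arithmetic conditions of Définition 5.2 are stable under products — proofs only

`Literature/Barriers/Schanuel/EFunctionValuesAtAlgebraicPointsArith.lean` — sibling file of
`EFunctionValuesAtAlgebraicPoints.lean` in the programme to discharge `siegelShidlovskii_algIndep`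
(Siegel–Shidlovskii; Rivoal Thm. 5.10), on the side of the REDUCTION of Thm. 5.10 to the rank
theorem 5.20 (`shidlovskii_rankBound`, `SiegelShidlovskiiRank.lean`) by "l'astuce de Siegel …
comme les `E`-fonctions forment un sous-anneau de `ℚ̄[[z]]`, une relation polynomiale sur `ℚ̄(z)`
entre des `E`-fonctions `F₁(z), …, Fₙ(z)` n'est rien d'autre qu'une relation linéaire sur `ℚ̄(z)`
entre les diverses `E`-fonctions que l'on obtient en faisant des produits des `Fⱼ(z)`"
(Rivoal p. 240). Base: the analytic dictionary of
`EFunctionValuesAtAlgebraicPointsSeries.lean` (`ExpBound`, `binomConv`, `eSeries_mul`,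
`deriv_eSeries`, `iteratedDeriv_eSeries`, `iteratedDeriv_eSeries_zero`). New here, all PROVED:

* small complements on `ExpBound`/`eSeries`: `ExpBound.of_norm_le`, `ExpBound.mulX` and
  `ExpBound.mul_eSeries` (`z · ∑ aₙzⁿ/n! = ∑ n aₙ₋₁ zⁿ/n!`), `ExpBound.summable_norm`, the
  pointwise `ExpBound.hasDerivAt_eSeries`, `ExpBound.eSeries_zero` (`F(0) = a₀`),
  `eSeries_binomConv_apply`, `eSeries_finset_sum`;
* `IsArithE a`: the ARITHMETIC part of Définition 5.2 — algebraic coefficients, (ii) conjugates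
  `≤ C^{n+1}`, (iii) denominators `1 ≤ Dₙ ≤ D^{n+1}` — i.e. `IsStrictEFunction` minus the
  differential condition (i) (`IsStrictEFunction.isArithE`, `IsArithE.isStrictEFunction`);
* **stability of `IsArithE` under the binomial convolution** (`isArithE_binomConv`): the
  conjugates `σ((a⋆b)ₙ) = ∑ (n choose k) σ(aₖ)σ(bₙ₋ₖ)` are controlled because every conjugate of
  an algebraic number is its image under a `ℚ`-embedding `ℚ̄ → ℂ`
  (`exists_algHom_apply_eq_of_mem_rootSet`, `algHom_apply_mem_rootSet`), and `DₙD′ₙ` is a common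
  denominator; hence under finite products (`eprodSeq`, `isArithE_eprodSeq`, `eSeries_eprodSeq`),
  with coefficients staying in any subfield containing the given ones (`eprodSeq_mem`).

Condition (i) for such products is NOT treated here: in Siegel's trick it follows from the
differential SYSTEM the monomials satisfy (cyclic-vector lemma, sibling file).

## References

* [Rivoal2024] T. Rivoal, *Les E-fonctions et G-fonctions de Siegel*, Journées X-UPS 2019
  (2024), doi:10.5802/xups.2019-03: Définition 5.2 (p. 227), §5.1 p. 228, §5.3 p. 240.
-/

noncomputable section

open Complex Polynomial Finset
open scoped Nat

namespace Literature.Barriers.Schanuel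

-- The `ℚ`-algebra diamond on subfields of `ℂ` (`DivisionRing.toRatAlgebra` vs
-- `IntermediateField.algebra`), handled as in `PeriodConjectureOverQbarScope.lean` and
-- `Literature/NumberTheory/Transcendental/OneMotiveToric.lean`: elaborate this file with the
-- latter only (Mathlib's instances on `algebraicClosure ℚ ℂ` are stated for it); the remaining
-- `Algebra ℚ ℂ` instance is definitionally the removed one, so statements agree across files.
attribute [-instance] DivisionRing.toRatAlgebra

variable {a b : ℕ → ℂ}

/-! ### 1. Complements on `ExpBound` and `eSeries` -/

/-- Domination by a geometrically bounded sequence. [folklore] -/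
theorem ExpBound.of_norm_le (hb : ExpBound b) (h : ∀ n, ‖a n‖ ≤ ‖b n‖) : ExpBound a := by
  obtain ⟨K, C, hK, hC, hb⟩ := hb
  exact ⟨K, C, hK, hC, fun n => (h n).trans (hb n)⟩

/-- The sequence `n ↦ n · aₙ₋₁` (coefficients of `z F(z)`) is geometrically bounded. [folklore] -/
theorem ExpBound.mulX (ha : ExpBound a) : ExpBound fun n => (n : ℂ) * a (n - 1) := by
  obtain ⟨K, C, hK, hC, ha⟩ := ha
  refine ⟨K, 2 * max C 1, hK, by positivity, fun n => ?_⟩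
  have h1 : (1 : ℝ) ≤ max C 1 := le_max_right _ _
  have hn : (n : ℝ) ≤ 2 ^ n := by exact_mod_cast Nat.lt_two_pow_self.le
  calc ‖(n : ℂ) * a (n - 1)‖ = n * ‖a (n - 1)‖ := by rw [norm_mul, Complex.norm_natCast]
    _ ≤ 2 ^ n * (K * C ^ (n - 1)) := by gcongr; exact ha _
    _ ≤ 2 ^ n * (K * (max C 1) ^ n) := by
        gcongr
        calc C ^ (n - 1) ≤ (max C 1) ^ (n - 1) := pow_le_pow_left₀ hC (le_max_left _ _) _
          _ ≤ (max C 1) ^ n := pow_le_pow_right₀ h1 (Nat.sub_le n 1)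
    _ = K * (2 * max C 1) ^ n := by rw [mul_pow]; ring

/-- Under `ExpBound` the `E`-series converges absolutely everywhere. [folklore] -/
theorem ExpBound.summable_norm (ha : ExpBound a) (z : ℂ) :
    Summable fun n => ‖a n * z ^ n / (n ! : ℂ)‖ := by
  obtain ⟨K, C, hK, hC, hb⟩ := ha
  refine .of_nonneg_of_le (fun n => norm_nonneg _) (fun n => ?_)
    ((Real.summable_pow_div_factorial (C * ‖z‖)).mul_left K)
  rw [norm_div, norm_mul, norm_pow, Complex.norm_natCast]
  calc ‖a n‖ * ‖z‖ ^ n / n ! ≤ K * C ^ n * ‖z‖ ^ n / n ! := by gcongr; exact hb n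
    _ = K * ((C * ‖z‖) ^ n / n !) := by rw [mul_pow]; ring

/-- Pointwise derivative: `(∑ aₙ zⁿ/n!)′(z) = ∑ aₙ₊₁ zⁿ/n!`. [folklore] -/
theorem ExpBound.hasDerivAt_eSeries (ha : ExpBound a) (z : ℂ) :
    HasDerivAt (eSeries a) (eSeries (fun n => a (n + 1)) z) z := by
  rw [← congr_fun (deriv_eSeries ha) z]
  exact ((differentiable_eSeries ha) z).hasDerivAt

/-- `F(0) = a₀`. [folklore] -/
theorem ExpBound.eSeries_zero (ha : ExpBound a) : eSeries a 0 = a 0 := by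
  simpa using iteratedDeriv_eSeries_zero ha 0

/-- `z · ∑ aₙ zⁿ/n! = ∑ n aₙ₋₁ zⁿ/n!`. [folklore] -/
theorem ExpBound.mul_eSeries (ha : ExpBound a) (z : ℂ) :
    z * eSeries a z = eSeries (fun n => (n : ℂ) * a (n - 1)) z := by
  have hs : Summable fun n : ℕ => (n : ℂ) * a (n - 1) * z ^ n / (n ! : ℂ) :=
    (ha.mulX.summable_norm z).of_norm
  unfold eSeries
  rw [hs.tsum_eq_zero_add, ← tsum_mul_left]
  simp only [Nat.cast_zero, zero_mul, zero_div, zero_add]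
  congr 1
  funext n
  have hn : ((n ! : ℕ) : ℂ) ≠ 0 := by exact_mod_cast (Nat.factorial_pos n).ne'
  have hn1 : ((n + 1 : ℕ) : ℂ) ≠ 0 := by exact_mod_cast Nat.succ_ne_zero n
  rw [Nat.add_sub_cancel, Nat.factorial_succ, Nat.cast_mul, pow_succ]
  field_simp

/-- Pointwise Cauchy product: `eSeries (a ⋆ b) z = eSeries a z · eSeries b z`. [folklore] -/
theorem eSeries_binomConv_apply (ha : ExpBound a) (hb : ExpBound b) (z : ℂ) :
    eSeries (binomConv a b) z = eSeries a z * eSeries b z := by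
  rw [← eSeries_mul ha hb, Pi.mul_apply]

/-- Finite additivity of `eSeries` in the coefficient sequence (under `ExpBound`). [folklore] -/
theorem eSeries_finset_sum {ι : Type*} (s : Finset ι) (f : ι → ℕ → ℂ)
    (h : ∀ i ∈ s, ExpBound (f i)) (z : ℂ) :
    eSeries (fun n => ∑ i ∈ s, f i n) z = ∑ i ∈ s, eSeries (f i) z := by
  unfold eSeries
  rw [← Summable.tsum_finsetSum fun i hi => ((h i hi).summable_norm z).of_norm]
  congr 1
  funext n
  rw [sum_mul, sum_div]

/-! ### 2. The arithmetic conditions of Définition 5.2 -/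

/-- The ARITHMETIC part of Définition 5.2 for a coefficient sequence `a`: `aₙ ∈ ℚ̄`; (ii) all
conjugates of `aₙ` have absolute value `≤ C^{n+1}`; (iii) integers `1 ≤ Dₙ ≤ D^{n+1}` with
`Dₙ aₘ ∈ O_ℚ̄` for `m ≤ n` — i.e. `IsStrictEFunction` without the differential condition (i)
(same conjuncts, verbatim). [cite: Rivoal2024, Définition 5.2] -/
def IsArithE (a : ℕ → ℂ) : Prop :=
  (∀ n, IsAlgebraic ℚ (a n)) ∧
  (∃ C : ℝ, 0 < C ∧ ∀ n, ∀ b ∈ (minpoly ℚ (a n)).rootSet ℂ, ‖b‖ ≤ C ^ (n + 1)) ∧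
  (∃ (D : ℕ → ℤ) (D₀ : ℝ), 0 < D₀ ∧ ∀ n, 1 ≤ D n ∧ (D n : ℝ) ≤ D₀ ^ (n + 1) ∧
    ∀ m ≤ n, IsIntegral ℤ ((D n : ℂ) * a m))

/-- A strict `E`-function satisfies the arithmetic conditions. [cite: Rivoal2024, Définition 5.2] -/
theorem IsStrictEFunction.isArithE (h : IsStrictEFunction a) : IsArithE a :=
  ⟨h.1, h.2.2.1, h.2.2.2⟩

/-- The arithmetic conditions plus a differential equation (i) make a strict `E`-function.
[cite: Rivoal2024, Définition 5.2] -/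
theorem IsArithE.isStrictEFunction (h : IsArithE a)
    (hODE : ∃ (m : ℕ) (P : Fin (m + 1) → Polynomial ℂ), P ≠ 0 ∧
      (∀ j k, IsAlgebraic ℚ ((P j).coeff k)) ∧
      ∀ z : ℂ, ∑ j : Fin (m + 1), (P j).eval z * iteratedDeriv j (eSeries a) z = 0) :
    IsStrictEFunction a :=
  ⟨h.1, hODE, h.2.1, h.2.2⟩

/-- The arithmetic conditions imply geometric growth of the coefficients (`aₙ` is a root of its
own minimal polynomial). [cite: Rivoal2024, Définition 5.2] -/
theorem IsArithE.expBound (h : IsArithE a) : ExpBound a := by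
  obtain ⟨C, hC, hb⟩ := h.2.1
  refine ⟨C, C, hC.le, hC.le, fun n => ?_⟩
  have hmem : a n ∈ (minpoly ℚ (a n)).rootSet ℂ := by
    rw [Polynomial.mem_rootSet]
    exact ⟨minpoly.ne_zero (h.1 n).isIntegral, minpoly.aeval ℚ (a n)⟩
  calc ‖a n‖ ≤ C ^ (n + 1) := hb n (a n) hmem
    _ = C * C ^ n := pow_succ' C n

/-- The constant `β ∈ ℚ̄` (sequence `(β, 0, 0, …)`) satisfies the arithmetic conditions.
[cite: Rivoal2024, §5.1 p. 228] -/
theorem isArithE_single {β : ℂ} (hβ : IsAlgebraic ℚ β) : IsArithE (Pi.single 0 β) :=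
  (isStrictEFunction_single hβ).isArithE

/-- **Conjugates are values of embeddings**: if `x ∈ ℚ̄ = algebraicClosure ℚ ℂ` and `b` is a
root of its minimal polynomial, some `ℚ`-algebra map `ψ : ℚ̄ → ℂ` sends `x` to `b`. [folklore] -/
theorem exists_algHom_apply_eq_of_mem_rootSet {x b : ℂ} (hx : x ∈ algebraicClosure ℚ ℂ)
    (hb : b ∈ (minpoly ℚ x).rootSet ℂ) :
    ∃ ψ : algebraicClosure ℚ ℂ →ₐ[ℚ] ℂ, ψ ⟨x, hx⟩ = b := by
  have hmin : minpoly ℚ (⟨x, hx⟩ : algebraicClosure ℚ ℂ) = minpoly ℚ x :=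
    IntermediateField.minpoly_eq _
  have : b ∈ (minpoly ℚ (⟨x, hx⟩ : algebraicClosure ℚ ℂ)).rootSet ℂ := by rwa [hmin]
  rwa [← Algebra.IsAlgebraic.range_eval_eq_rootSet_minpoly ℂ] at this

/-- An embedding `ψ : ℚ̄ → ℂ` sends `y ∈ ℚ̄` to a conjugate of `y`. [folklore] -/
theorem algHom_apply_mem_rootSet (ψ : algebraicClosure ℚ ℂ →ₐ[ℚ] ℂ)
    (y : algebraicClosure ℚ ℂ) : ψ y ∈ (minpoly ℚ (y : ℂ)).rootSet ℂ := by
  rw [← IntermediateField.minpoly_eq, ← Algebra.IsAlgebraic.range_eval_eq_rootSet_minpoly ℂ y]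
  exact Set.mem_range_self ψ

/-- **Products preserve the arithmetic conditions** ("les `E`-fonctions forment un sous-anneau
de `ℚ̄[[z]]`", arithmetic part): conjugates `σ((a⋆b)ₙ) = ∑ (n choose k) σ(aₖ)σ(bₙ₋ₖ)` are bounded
by `C C′ (C + C′)ⁿ ≤ (CC′ + C + C′)^{n+1}`, and `Dₙ D′ₙ` is a common denominator.
[cite: Rivoal2024, §5.3 p. 240] -/
theorem isArithE_binomConv (ha : IsArithE a) (hb : IsArithE b) : IsArithE (binomConv a b) := by
  obtain ⟨halg, ⟨C, hC, hconj⟩, ⟨D, D₀, hD₀, hden⟩⟩ := ha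
  obtain ⟨halg', ⟨C', hC', hconj'⟩, ⟨D', D₀', hD₀', hden'⟩⟩ := hb
  -- the coefficients as elements of `ℚ̄`
  set Qb := algebraicClosure ℚ ℂ
  have hmemA : ∀ k, a k ∈ Qb := fun k => mem_algebraicClosure_iff.mpr (halg k)
  have hmemB : ∀ k, b k ∈ Qb := fun k => mem_algebraicClosure_iff.mpr (halg' k)
  have hmemE : ∀ n, binomConv a b n ∈ Qb := fun n =>
    Qb.sum_mem fun k _ => mul_mem (mul_mem (natCast_mem Qb _) (hmemA k)) (hmemB (n - k))
  refine ⟨fun n => mem_algebraicClosure_iff.mp (hmemE n), ?_, ?_⟩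
  · -- (ii) conjugates
    refine ⟨C * C' + C + C', by positivity, fun n β hβ => ?_⟩
    obtain ⟨ψ, hψ⟩ := exists_algHom_apply_eq_of_mem_rootSet (hmemE n) hβ
    have hx : (⟨binomConv a b n, hmemE n⟩ : Qb) =
        ∑ k ∈ range (n + 1), (n.choose k : Qb) * (⟨a k, hmemA k⟩ : Qb) * ⟨b (n - k), hmemB (n - k)⟩ := by
      apply Subtype.ext
      push_cast
      rfl
    rw [← hψ, hx, map_sum]
    calc ‖∑ k ∈ range (n + 1), ψ ((n.choose k : Qb) * (⟨a k, hmemA k⟩ : Qb) * ⟨b (n - k), hmemB (n - k)⟩)‖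
        ≤ ∑ k ∈ range (n + 1), (n.choose k : ℝ) * C ^ (k + 1) * C' ^ (n - k + 1) := by
          refine (norm_sum_le _ _).trans (sum_le_sum fun k _ => ?_)
          rw [map_mul, map_mul, map_natCast, norm_mul, norm_mul, Complex.norm_natCast]
          gcongr
          · exact hconj k _ (algHom_apply_mem_rootSet ψ ⟨a k, hmemA k⟩)
          · exact hconj' (n - k) _ (algHom_apply_mem_rootSet ψ ⟨b (n - k), hmemB (n - k)⟩)
      _ = C * C' * (C + C') ^ n := by
          rw [add_pow, mul_sum]
          refine sum_congr rfl fun k _ => ?_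
          ring
      _ ≤ (C * C' + C + C') * (C * C' + C + C') ^ n := by
          gcongr
          · nlinarith
          · nlinarith
      _ = (C * C' + C + C') ^ (n + 1) := (pow_succ' _ _).symm
  · -- (iii) denominators
    refine ⟨fun n => D n * D' n, D₀ * D₀', by positivity, fun n => ⟨?_, ?_, fun m hm => ?_⟩⟩
    · exact one_le_mul_of_one_le_of_one_le (hden n).1 (hden' n).1
    · have h0 : (0 : ℝ) ≤ D' n := by exact_mod_cast (zero_le_one.trans (hden' n).1)
      have h0' : (0 : ℝ) ≤ D₀ ^ (n + 1) := by positivity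
      push_cast
      rw [mul_pow]
      exact mul_le_mul (hden n).2.1 (hden' n).2.1 h0 h0'
    · have : ((D n * D' n : ℤ) : ℂ) * binomConv a b m =
          ∑ k ∈ range (m + 1), (m.choose k : ℂ) * ((D n : ℂ) * a k * ((D' n : ℂ) * b (m - k))) := by
        push_cast
        rw [binomConv, mul_sum]
        refine sum_congr rfl fun k _ => ?_
        ring
      rw [this]
      refine IsIntegral.sum _ fun k hk => ?_
      have hkm : k ≤ m := Nat.lt_succ_iff.mp (mem_range.mp hk)
      exact (isIntegral_natCast _).mul
        (((hden n).2.2 k (hkm.trans hm)).mul ((hden' n).2.2 (m - k) ((Nat.sub_le m k).trans hm)))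

/-! ### 3. Finite products of `E`-series -/

/-- Coefficient sequence of the product of the `E`-series in a list: iterated binomial
convolution, starting from the constant `1 = (1, 0, 0, …)`. [folklore] -/
def eprodSeq : List (ℕ → ℂ) → ℕ → ℂ :=
  List.foldr binomConv (Pi.single 0 1)

/-- `eprodSeq [] = (1, 0, 0, …)`. [folklore] -/
@[simp] theorem eprodSeq_nil : eprodSeq [] = Pi.single 0 1 := rfl

/-- `eprodSeq (a :: l) = a ⋆ eprodSeq l`. [folklore] -/
@[simp] theorem eprodSeq_cons (a : ℕ → ℂ) (l : List (ℕ → ℂ)) :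
    eprodSeq (a :: l) = binomConv a (eprodSeq l) := rfl

/-- Finite products preserve the arithmetic conditions. [cite: Rivoal2024, §5.3 p. 240] -/
theorem isArithE_eprodSeq (l : List (ℕ → ℂ)) (h : ∀ a ∈ l, IsArithE a) : IsArithE (eprodSeq l) := by
  induction l with
  | nil => simpa using isArithE_single isAlgebraic_one
  | cons a l ih =>
    rw [eprodSeq_cons]
    exact isArithE_binomConv (h a (by simp)) (ih fun b hb => h b (by simp [hb]))

/-- Finite products of geometrically bounded sequences are geometrically bounded. [folklore] -/
theorem expBound_eprodSeq (l : List (ℕ → ℂ)) (h : ∀ a ∈ l, ExpBound a) :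
    ExpBound (eprodSeq l) := by
  induction l with
  | nil => simpa using (isArithE_single isAlgebraic_one).expBound
  | cons a l ih =>
    rw [eprodSeq_cons]
    exact (h a (by simp)).conv (ih fun b hb => h b (by simp [hb]))

/-- **The `E`-series of `eprodSeq l` is the product of the `E`-series of the members of `l`.**
[folklore] -/
theorem eSeries_eprodSeq (l : List (ℕ → ℂ)) (h : ∀ a ∈ l, ExpBound a) (z : ℂ) :
    eSeries (eprodSeq l) z = (l.map fun a => eSeries a z).prod := by
  induction l with
  | nil => simp [eSeries_single]
  | cons a l ih =>
    rw [eprodSeq_cons, eSeries_binomConv_apply (h a (by simp))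
      (expBound_eprodSeq l fun b hb => h b (by simp [hb])), ih fun b hb => h b (by simp [hb])]
    simp

/-- The convolution of sequences with values in a subfield `K ⊆ ℂ` has values in `K`. [folklore] -/
theorem binomConv_mem (K : IntermediateField ℚ ℂ) (ha : ∀ n, a n ∈ K) (hb : ∀ n, b n ∈ K) (n : ℕ) :
    binomConv a b n ∈ K :=
  K.sum_mem fun k _ => mul_mem (mul_mem (natCast_mem K _) (ha k)) (hb (n - k))

/-- Finite products of sequences with values in a subfield `K ⊆ ℂ` have values in `K`. [folklore] -/
theorem eprodSeq_mem (K : IntermediateField ℚ ℂ) (l : List (ℕ → ℂ))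
    (h : ∀ a ∈ l, ∀ n, a n ∈ K) (n : ℕ) : eprodSeq l n ∈ K := by
  induction l generalizing n with
  | nil =>
    rcases eq_or_ne n 0 with rfl | hn
    · simp
    · simp [Pi.single_eq_of_ne hn]
  | cons a l ih =>
    rw [eprodSeq_cons]
    exact binomConv_mem K (h a (by simp)) (fun k => ih (fun b hb => h b (by simp [hb])) k) n

end Literature.Barriers.Schanuel

end
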